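import Literature.Probability.RandomPlanarGeometry.SAWTriangularStripBridges
import Literature.Probability.RandomPlanarGeometry.SAWTriangularBridgeConstant
import HarnessLib

/-!
# Locality of the connective constant of the triangular lattice in strips, with an explicit rate:
# `0 ≤ log μ(𝕋) − log μ(S_T) ≤ 40/√T`

Topic `Literature/Probability/RandomPlanarGeometry` (continues `SAWTriangularStrip.lean` — the row strips
`S_T = {0 ≤ Y ≤ T}` of `𝕋`, `TriStrip.stripConnectiveConstant T = μ(S_T) ≤ μ(𝕋)`, monotone in `T` — and
`SAWTriangularStripBridges.lean` — for every `N` a class size `B` with `b_N(𝕋) ≤ (2N+1) B` and `B^{2j} ≤ c_{2jN}(S_{4N})`).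
Source: N. Madras, G. Slade, *The Self-Avoiding Walk* (1993), Theorem 8.2.1, eq. (8.2.12), p. 269: "`lim_{T→∞} μ(R[k,T]) = μ`"
(tubes and slabs of `ℤ^d`; a LIMIT, whose proof (8.2.14) gives a rate only implicitly once combined with the
Hammersley–Welsh envelope Corollary 3.1.6 (3.1.9), p. 61).  The tree has the quantified version for `ℤ^d`
(`Zd.log_sub_log_tubeConnectiveConstant_le`) and for the honeycomb lattice (`HexBW.log_sub_log_stripConnectiveConstant_le`,
`30/√T`); this file is the triangular-lattice member of the trio, by the same scheme: the counting inequality of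
`SAWTriangularStripBridges`, the tree's lower envelope `exp_neg_mul_pow_le_brickBridgeCount : e^{−15√n} μ(𝕋)^n ≤ b_n(𝕋)`
(Madras–Slade (3.1.9) on `𝕋`) and `μ(𝕋) ≤ 5` (`logMuTri_le_log_five`).

## Main statements (namespace `Literature.Probability.RandomPlanarGeometry.SAW.TriStrip`, all PROVED)

* `log_sub_log_stripConnectiveConstant_four_mul_le` — `log μ(𝕋) − log μ(S_{4N}) ≤ (15√N + log(2N+1))/N` (`N ≥ 1`);
* **`log_sub_log_stripConnectiveConstant_le`** — for every `T ≥ 1`: `0 ≤ log μ(𝕋) − log μ(S_T) ≤ 40/√T`;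
* `exists_log_sub_log_stripConnectiveConstant_le`, `mul_exp_neg_le_stripConnectiveConstant`,
  `sub_stripConnectiveConstant_le` (`0 ≤ μ(𝕋) − μ(S_T) ≤ 200/√T`), **`tendsto_stripConnectiveConstant`** (locality,
  (8.2.12) on `𝕋`), `iSup_stripConnectiveConstant`;
* **`log_sub_log_stripConnectiveConstant_le_eventually`** — for every `η > 0`, eventually
  `log μ(𝕋) − log μ(S_T) ≤ (30 + η)/√T` (the asymptotic constant `2 · 15` of the proof).

Printed status (literature cell lit-2 gen 13, 2026-08-23, both corpora): the printed statements are for `ℤ^d` only —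
Madras–Slade Theorem 8.2.1 p. 269, "(8.2.12) `lim_{T→∞} μ(R[k,T]) = μ` and (8.2.13) `μ(R[k,T]) < μ(R[k,T+1])`",
qualitative, proof via bridges ending on the axis (Lemma 8.1.8, Prop 8.1.2, Cor 3.2.5), NO RATE anywhere in print — and
Grimmett–Li's qualitative locality theorem for transitive graphs with height functions [cite: GrimmettLi2018Locality]; for
the honeycomb lattice the limit and the strict monotonicity are printed via the strip identity (BBdGDCG 2014 Prop. 7 at
`y = 1`); for the TRIANGULAR lattice nothing is printed (the transfer-matrix literature — Jensen 2004 §2, Alm 2005 — uses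
finite strips of `𝕋` as a device and states no `T → ∞` theorem).  So this file is consolidation with a rate: the limit
is the expected `𝕋`-analogue of (8.2.12), the explicit rate is the lane's (the `√T`-rate is the Hammersley–Welsh artefact,
not sharp).
-/

noncomputable section

open Filter Topology Finset Literature.Probability.LatticeModels Literature.Probability.Percolation SimpleGraph

namespace Literature.Probability.RandomPlanarGeometry.SAW

namespace TriStrip

/-! ### The rate at width `4N` -/

/-- From `B^j ≤ c_{jM}(S_T)` for all `j` (`M ≥ 1`): `B^{1/M} ≤ μ(S_T)` (private: the statement has the shape of the
honeycomb twin `HexBW.rpow_le_stripConnectiveConstant`). [cite: MadrasSlade1993, §8.2, proof of Theorem 8.2.1] -/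
private theorem rpow_le_stripConnectiveConstant {T M B : ℕ} (hM : 1 ≤ M) (h : ∀ j : ℕ, B ^ j ≤ stripCount T (j * M)) :
    (B : ℝ) ^ (1 / (M : ℝ)) ≤ stripConnectiveConstant T := by
  have hsub : Tendsto (fun j : ℕ => j * M) atTop atTop := tendsto_id.atTop_mul_const' (by omega)
  have hlim := (tendsto_stripCount_rpow T).comp hsub
  refine ge_of_tendsto hlim ?_
  filter_upwards [eventually_ge_atTop 1] with j hj
  have hjM : (j * M : ℕ) ≠ 0 := Nat.mul_ne_zero (by omega) (by omega)
  have hB : (0 : ℝ) ≤ B := Nat.cast_nonneg _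
  rw [Function.comp_apply]
  have h1 : ((B : ℝ) ^ j) ^ (1 / ((j * M : ℕ) : ℝ)) = (B : ℝ) ^ (1 / (M : ℝ)) := by
    rw [← Real.rpow_natCast, ← Real.rpow_mul hB]
    congr 1
    have hj' : (j : ℝ) ≠ 0 := by exact_mod_cast (show j ≠ 0 by omega)
    push_cast
    field_simp
  rw [← h1]
  exact Real.rpow_le_rpow (pow_nonneg hB _) (by exact_mod_cast h j) (by positivity)

/-- **The rate at width `4N`**: `log μ(𝕋) − log μ(S_{4N}) ≤ (15√N + log(2N+1))/N` for `N ≥ 1`.  Ingredients: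
`μ(S_{4N}) ≥ B^{1/N}`, `b_N(𝕋) ≤ (2N+1) B` and the envelope `e^{−15√N} μ(𝕋)^N ≤ b_N(𝕋)`.
[cite: MadrasSlade1993, Theorem 8.2.1 (8.2.12) and its proof, (8.2.14) (p. 269); Corollary 3.1.6 (3.1.9)] -/
theorem log_sub_log_stripConnectiveConstant_four_mul_le {N : ℕ} (hN : 1 ≤ N) :
    logMuTri - Real.log (stripConnectiveConstant (4 * N)) ≤ (15 * Real.sqrt N + Real.log (2 * N + 1)) / N := by
  obtain ⟨B, hbB, hB⟩ := exists_pow_le_stripCount N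
  set μ := Real.exp logMuTri with hμdef
  have hμ : 0 < μ := Real.exp_pos _
  have hNr : (0 : ℝ) < N := by exact_mod_cast hN
  -- `e^{-15√N} μ^N ≤ b_N ≤ (2N+1) B`
  have h1 : Real.exp (-(15 * Real.sqrt N)) * μ ^ N ≤ brickBridgeCount N := exp_neg_mul_pow_le_brickBridgeCount N
  have h2 : (brickBridgeCount N : ℝ) ≤ (2 * (N : ℝ) + 1) * B := by exact_mod_cast hbB
  have hBpos : (0 : ℝ) < B := by
    have hb : (0 : ℝ) < brickBridgeCount N := by exact_mod_cast one_le_brickBridgeCount N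
    have hP0 : (0 : ℝ) < 2 * (N : ℝ) + 1 := by positivity
    nlinarith [hb, h2, hP0]
  have h3 : Real.exp (-(15 * Real.sqrt N)) * μ ^ N ≤ (2 * (N : ℝ) + 1) * B := h1.trans h2
  -- `B^{1/N} ≤ μ(S_{4N})`
  have h4 : (B : ℝ) ^ (1 / (N : ℝ)) ≤ stripConnectiveConstant (4 * N) := by
    have h := rpow_le_stripConnectiveConstant (T := 4 * N) (M := 2 * N) (B := B ^ 2) (by omega)
      (fun j => by rw [← pow_mul]; exact hB j)
    have e : ((B ^ 2 : ℕ) : ℝ) ^ (1 / ((2 * N : ℕ) : ℝ)) = (B : ℝ) ^ (1 / (N : ℝ)) := by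
      push_cast
      rw [← Real.rpow_natCast (B : ℝ) 2, ← Real.rpow_mul hBpos.le]
      congr 1
      push_cast
      field_simp
    rwa [e] at h
  -- logarithms
  have hS : 0 < stripConnectiveConstant (4 * N) := stripConnectiveConstant_pos _
  have hlog4 : Real.log B ≤ (N : ℝ) * Real.log (stripConnectiveConstant (4 * N)) := by
    have h := Real.log_le_log (Real.rpow_pos_of_pos hBpos _) h4
    rw [Real.log_rpow hBpos] at h
    have h' := mul_le_mul_of_nonneg_left h hNr.le
    rwa [← mul_assoc, mul_one_div_cancel hNr.ne', one_mul] at h'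
  have hlog3 : -(15 * Real.sqrt N) + (N : ℝ) * logMuTri ≤ Real.log (2 * (N : ℝ) + 1) + Real.log B := by
    have := Real.log_le_log (by positivity) h3
    rw [Real.log_mul (Real.exp_pos _).ne' (pow_pos hμ _).ne', Real.log_exp, Real.log_pow, hμdef, Real.log_exp,
      Real.log_mul (by positivity) hBpos.ne'] at this
    exact this
  rw [le_div_iff₀ hNr]
  nlinarith [hlog3, hlog4]

/-! ### The rate for every width -/

/-- `log μ(𝕋) ≤ 4` (from `μ(𝕋) ≤ 5`, `log x ≤ x − 1`). [cite: MadrasSlade1993, §1.2, (1.2.3)] -/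
private theorem logMuTri_le_four : logMuTri ≤ 4 := by
  have h := Real.log_le_sub_one_of_pos (show (0 : ℝ) < 5 by norm_num)
  linarith [logMuTri_le_log_five]

/-- **Locality of `μ(𝕋)` in strips with an explicit rate** (Madras–Slade Theorem 8.2.1 (8.2.12), triangular version,
quantified): for every `T ≥ 1`, `0 ≤ log μ(𝕋) − log μ(S_T) ≤ 40 / √T`.  Proof: for `T < 8` the left side is at most
`log μ(𝕋) ≤ log 5`; for `T ≥ 8` take `N = ⌊T/4⌋ ≥ 2` (`4N ≤ T ≤ 4N + 3 ≤ 11N/2`), use monotonicity in the width and the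
rate at width `4N` with `log(2N+1) ≤ 2√N`: `(15√N + log(2N+1))/N ≤ 17/√N ≤ 17√(11/2)/√T ≤ 40/√T`.
[cite: MadrasSlade1993, Theorem 8.2.1 (8.2.12) and its proof, (8.2.14) (p. 269); Corollary 3.1.6 (3.1.9) (p. 61)] -/
theorem log_sub_log_stripConnectiveConstant_le {T : ℕ} (hT : 1 ≤ T) :
    0 ≤ logMuTri - Real.log (stripConnectiveConstant T) ∧
    logMuTri - Real.log (stripConnectiveConstant T) ≤ 40 / Real.sqrt T := by
  have hlogμ' : logMuTri ≤ 4 := logMuTri_le_four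
  have hTpos : 0 < stripConnectiveConstant T := stripConnectiveConstant_pos T
  have hupper : Real.log (stripConnectiveConstant T) ≤ logMuTri := by
    have := Real.log_le_log hTpos (stripConnectiveConstant_le T)
    rwa [Real.log_exp] at this
  have hlower : 0 ≤ Real.log (stripConnectiveConstant T) := Real.log_nonneg (one_le_stripConnectiveConstant T)
  refine ⟨by linarith, ?_⟩
  have hTr : (1 : ℝ) ≤ T := by exact_mod_cast hT
  have hsT : 1 ≤ Real.sqrt T := by rw [Real.le_sqrt' one_pos]; linarith
  have hsT0 : 0 < Real.sqrt T := by linarith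
  by_cases h8 : T < 8
  · -- small widths: `√T ≤ 3`
    have hs3 : Real.sqrt T ≤ 3 := by
      rw [Real.sqrt_le_left (by norm_num)]
      exact_mod_cast (show T ≤ 9 by omega)
    rw [le_div_iff₀ hsT0]
    nlinarith [hupper, hlower, hs3]
  · -- `T ≥ 8`: `N = T/4 ≥ 2`, `4N ≤ T`, `2T ≤ 11N`
    rw [not_lt] at h8
    set N := T / 4 with hNdef
    have hN2 : 2 ≤ N := by omega
    have h4N : 4 * N ≤ T := by omega
    have hT11 : 2 * T ≤ 11 * N := by omega
    have hNr : (2 : ℝ) ≤ N := by exact_mod_cast hN2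
    have hmono' : Real.log (stripConnectiveConstant (4 * N)) ≤ Real.log (stripConnectiveConstant T) :=
      Real.log_le_log (stripConnectiveConstant_pos _) (stripConnectiveConstant_mono h4N)
    have hrate := log_sub_log_stripConnectiveConstant_four_mul_le (N := N) (by omega)
    have hsN : 1 ≤ Real.sqrt N := by rw [Real.le_sqrt' one_pos]; linarith
    have hlogN : Real.log N ≤ 2 * Real.sqrt N - 2 := by
      have h := Real.log_le_sub_one_of_pos (show 0 < Real.sqrt N by linarith)
      rw [Real.log_sqrt (by positivity)] at h
      linarith
    have hlog3 : Real.log 3 < 2 := by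
      have : Real.log 3 < 3 - 1 := Real.log_lt_sub_one_of_pos (by norm_num) (by norm_num)
      linarith
    have hlog2N : Real.log (2 * N + 1) ≤ 2 * Real.sqrt N := by
      have h1 : Real.log (2 * N + 1) ≤ Real.log (3 * N) := Real.log_le_log (by linarith) (by linarith)
      rw [Real.log_mul (by norm_num) (by linarith)] at h1
      linarith
    -- `√T ≤ (47/20) √N` from `2T ≤ 11N` and `√(11/2) ≤ 47/20`
    have hs112 : Real.sqrt (11 / 2) ≤ 47 / 20 := by
      rw [Real.sqrt_le_left (by norm_num)]; norm_num
    have hsTN : Real.sqrt T ≤ 47 / 20 * Real.sqrt N := by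
      have hT' : (T : ℝ) ≤ 11 / 2 * N := by
        have : (2 * T : ℝ) ≤ 11 * N := by exact_mod_cast hT11
        linarith
      calc Real.sqrt T ≤ Real.sqrt (11 / 2 * N) := Real.sqrt_le_sqrt hT'
        _ = Real.sqrt (11 / 2) * Real.sqrt N := Real.sqrt_mul (by norm_num) _
        _ ≤ 47 / 20 * Real.sqrt N := mul_le_mul_of_nonneg_right hs112 (by linarith)
    have hsN0 : 0 < Real.sqrt N := by linarith
    have hNsq : (N : ℝ) = Real.sqrt N * Real.sqrt N := (Real.mul_self_sqrt (by linarith)).symm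
    have hnum : 15 * Real.sqrt N + Real.log (2 * N + 1) ≤ 17 * Real.sqrt N := by linarith
    have hstep : logMuTri - Real.log (stripConnectiveConstant (4 * N)) ≤ 17 / Real.sqrt N := by
      refine hrate.trans ?_
      rw [div_le_div_iff₀ (by linarith) hsN0]
      calc (15 * Real.sqrt N + Real.log (2 * N + 1)) * Real.sqrt N ≤ (17 * Real.sqrt N) * Real.sqrt N :=
            mul_le_mul_of_nonneg_right hnum hsN0.le
        _ = 17 * (Real.sqrt N * Real.sqrt N) := by ring
        _ = 17 * N := by rw [← hNsq]
    have hfin : 17 / Real.sqrt N ≤ 40 / Real.sqrt T := by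
      rw [div_le_div_iff₀ hsN0 hsT0]
      calc 17 * Real.sqrt T ≤ 17 * (47 / 20 * Real.sqrt N) := mul_le_mul_of_nonneg_left hsTN (by norm_num)
        _ ≤ 40 * Real.sqrt N := by nlinarith [hsN0]
    linarith

/-- The same with the constant packaged existentially. [cite: MadrasSlade1993, Theorem 8.2.1, eq. (8.2.12)] -/
theorem exists_log_sub_log_stripConnectiveConstant_le :
    ∃ C : ℝ, ∀ T : ℕ, 1 ≤ T →
      0 ≤ logMuTri - Real.log (stripConnectiveConstant T) ∧
      logMuTri - Real.log (stripConnectiveConstant T) ≤ C / Real.sqrt T :=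
  ⟨40, fun _ hT => log_sub_log_stripConnectiveConstant_le hT⟩

/-- The rate in multiplicative form: `μ(𝕋) · e^{−40/√T} ≤ μ(S_T) ≤ μ(𝕋)` for `T ≥ 1`.
[cite: MadrasSlade1993, Theorem 8.2.1, eq. (8.2.12)] -/
theorem mul_exp_neg_le_stripConnectiveConstant {T : ℕ} (hT : 1 ≤ T) :
    Real.exp logMuTri * Real.exp (-(40 / Real.sqrt T)) ≤ stripConnectiveConstant T ∧
      stripConnectiveConstant T ≤ Real.exp logMuTri := by
  have h := (log_sub_log_stripConnectiveConstant_le hT).2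
  have hpos := stripConnectiveConstant_pos T
  refine ⟨?_, stripConnectiveConstant_le T⟩
  have : Real.log (Real.exp logMuTri * Real.exp (-(40 / Real.sqrt T))) ≤ Real.log (stripConnectiveConstant T) := by
    rw [Real.log_mul (Real.exp_pos _).ne' (Real.exp_pos _).ne', Real.log_exp, Real.log_exp]
    linarith
  exact (Real.log_le_log_iff (by positivity) hpos).1 this

/-- **The deficit form**: `0 ≤ μ(𝕋) − μ(S_T) ≤ 200/√T` for `T ≥ 1` (from `μ(𝕋) e^{−40/√T} ≤ μ(S_T)`, `1 − x ≤ e^{−x}`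
and `μ(𝕋) ≤ 5`). [cite: MadrasSlade1993, Theorem 8.2.1 (8.2.12) and its proof, (8.2.14) (p. 269)] -/
theorem sub_stripConnectiveConstant_le {T : ℕ} (hT : 1 ≤ T) :
    0 ≤ Real.exp logMuTri - stripConnectiveConstant T ∧
      Real.exp logMuTri - stripConnectiveConstant T ≤ 200 / Real.sqrt T := by
  obtain ⟨hlo, hhi⟩ := mul_exp_neg_le_stripConnectiveConstant hT
  refine ⟨by linarith, ?_⟩
  have hμ : 0 < Real.exp logMuTri := Real.exp_pos _
  have hμ' : Real.exp logMuTri ≤ 5 := by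
    rw [← Real.exp_log (show (0 : ℝ) < 5 by norm_num)]
    exact Real.exp_le_exp.2 logMuTri_le_log_five
  have hsT0 : 0 < Real.sqrt T := Real.sqrt_pos.2 (by exact_mod_cast (show 0 < T by omega))
  have hexp : 1 - 40 / Real.sqrt T ≤ Real.exp (-(40 / Real.sqrt T)) := by
    have := Real.add_one_le_exp (-(40 / Real.sqrt T))
    linarith
  have h1 : Real.exp logMuTri * (1 - 40 / Real.sqrt T) ≤ stripConnectiveConstant T :=
    (mul_le_mul_of_nonneg_left hexp hμ.le).trans hlo
  have h40 : 0 ≤ 40 / Real.sqrt T := by positivity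
  rw [div_eq_mul_one_div (200 : ℝ), show (40 : ℝ) / Real.sqrt T = 40 * (1 / Real.sqrt T) by ring] at *
  nlinarith [h1, hμ', h40, hμ]

/-- **Madras–Slade Theorem 8.2.1 (8.2.12) on the triangular lattice**: `lim_{T→∞} μ(S_T) = μ(𝕋)` (locality of the
connective constant of `𝕋` in strips).
[cite: MadrasSlade1993, Theorem 8.2.1 (8.2.12) and its proof, (8.2.14) (p. 269); Corollary 3.1.6 (3.1.9) (p. 61)]
[cite: GrimmettLi2018Locality] -/
theorem tendsto_stripConnectiveConstant :
    Tendsto (fun T : ℕ => stripConnectiveConstant T) atTop (𝓝 (Real.exp logMuTri)) := by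
  set μ := Real.exp logMuTri with hμdef
  have hlim : Tendsto (fun T : ℕ => μ * Real.exp (-(40 / Real.sqrt T))) atTop (𝓝 μ) := by
    have h1 : Tendsto (fun T : ℕ => (40 : ℝ) / Real.sqrt (T : ℝ)) atTop (𝓝 0) := by
      have hs : Tendsto (fun T : ℕ => Real.sqrt (T : ℝ)) atTop atTop :=
        Real.tendsto_sqrt_atTop.comp tendsto_natCast_atTop_atTop
      exact hs.const_div_atTop 40
    have h1' : Tendsto (fun T : ℕ => -((40 : ℝ) / Real.sqrt (T : ℝ))) atTop (𝓝 0) := by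
      simpa using h1.neg
    have h2 : Tendsto (fun T : ℕ => Real.exp (-((40 : ℝ) / Real.sqrt (T : ℝ)))) atTop (𝓝 1) := by
      have := (Real.continuous_exp.tendsto 0).comp h1'
      rwa [Real.exp_zero] at this
    simpa using h2.const_mul μ
  refine tendsto_of_tendsto_of_tendsto_of_le_of_le' hlim tendsto_const_nhds ?_ ?_
  · filter_upwards [eventually_ge_atTop 1] with T hT using (mul_exp_neg_le_stripConnectiveConstant hT).1
  · filter_upwards [eventually_ge_atTop 1] with T hT using (mul_exp_neg_le_stripConnectiveConstant hT).2

/-- **`μ(S_T) ↑ μ(𝕋)`**: `μ(𝕋) = sup_T μ(S_T)`. [cite: MadrasSlade1993, Theorem 8.2.1, eq. (8.2.12)] -/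
theorem iSup_stripConnectiveConstant : (⨆ T : ℕ, stripConnectiveConstant T) = Real.exp logMuTri := by
  have hbdd : BddAbove (Set.range stripConnectiveConstant) :=
    ⟨Real.exp logMuTri, by rintro _ ⟨T, rfl⟩; exact stripConnectiveConstant_le T⟩
  have hmono : Monotone stripConnectiveConstant := fun _ _ h => stripConnectiveConstant_mono h
  exact tendsto_nhds_unique (tendsto_atTop_ciSup hmono hbdd) tendsto_stripConnectiveConstant

/-! ### The asymptotic constant `30 = 2 · 15` -/

/-- `log N / √N → 0`. [folklore] -/
private theorem tendsto_log_div_sqrt : Tendsto (fun N : ℕ => Real.log N / Real.sqrt N) atTop (𝓝 0) := by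
  have h := (isLittleO_log_rpow_atTop (by norm_num : (0 : ℝ) < 1 / 2)).tendsto_div_nhds_zero
  refine (h.comp tendsto_natCast_atTop_atTop).congr fun N => ?_
  rw [Function.comp_apply, Real.sqrt_eq_rpow]

/-- The majorant `g(N) = ((log 3 + log N)/√N + 15) · √(4 + 3/N)` of `N ↦ r(N) √(4N+3)` tends to `30`.
[cite: MadrasSlade1993, Theorem 8.2.1 (8.2.12) and its proof] -/
private theorem tendsto_majorant :
    Tendsto (fun N : ℕ => ((Real.log 3 + Real.log N) / Real.sqrt N + 15) * Real.sqrt (4 + 3 / (N : ℝ))) atTop (𝓝 30) := by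
  have hs : Tendsto (fun N : ℕ => Real.sqrt (N : ℝ)) atTop atTop :=
    Real.tendsto_sqrt_atTop.comp tendsto_natCast_atTop_atTop
  have h1 : Tendsto (fun N : ℕ => Real.log 3 / Real.sqrt N) atTop (𝓝 0) := hs.const_div_atTop _
  have h2 : Tendsto (fun N : ℕ => (Real.log 3 + Real.log N) / Real.sqrt N + 15) atTop (𝓝 (0 + 0 + 15)) := by
    refine ((h1.add tendsto_log_div_sqrt).add tendsto_const_nhds).congr fun N => ?_
    ring
  have h3 : Tendsto (fun N : ℕ => (4 : ℝ) + 3 / (N : ℝ)) atTop (𝓝 (4 + 0)) :=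
    tendsto_const_nhds.add (tendsto_const_div_atTop_nhds_zero_nat 3)
  have h4 : Tendsto (fun N : ℕ => Real.sqrt (4 + 3 / (N : ℝ))) atTop (𝓝 2) := by
    have := (Real.continuous_sqrt.tendsto _).comp h3
    rwa [add_zero, show Real.sqrt 4 = 2 by
      rw [show (4 : ℝ) = 2 ^ 2 by norm_num, Real.sqrt_sq (by norm_num)]] at this
  have := h2.mul h4
  norm_num at this
  exact this

/-- `T/4 → ∞`. [folklore] -/
private theorem tendsto_quarter : Tendsto (fun T : ℕ => T / 4) atTop atTop := by
  refine tendsto_atTop_atTop.2 fun b => ⟨4 * b, fun T hT => ?_⟩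
  show b ≤ T / 4
  omega

/-- **The asymptotic constant `2 · 15 = 30`**: for every `η > 0`, eventually in `T`,
`log μ(𝕋) − log μ(S_T) ≤ (30 + η)/√T` (the rate at width `4N`, `N = ⌊T/4⌋`, `T ≤ 4N + 3`, `log(2N+1)/√N → 0`).
[cite: MadrasSlade1993, Theorem 8.2.1 (8.2.12) and its proof, (8.2.14) (p. 269); Corollary 3.1.6 (3.1.9) (p. 61)] -/
theorem log_sub_log_stripConnectiveConstant_le_eventually {η : ℝ} (hη : 0 < η) :
    ∀ᶠ T : ℕ in atTop, logMuTri - Real.log (stripConnectiveConstant T) ≤ (30 + η) / Real.sqrt T := by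
  have hev : ∀ᶠ N : ℕ in atTop,
      ((Real.log 3 + Real.log N) / Real.sqrt N + 15) * Real.sqrt (4 + 3 / (N : ℝ)) ≤ 30 + η :=
    tendsto_majorant.eventually (Iic_mem_nhds (by linarith))
  filter_upwards [tendsto_quarter.eventually hev, eventually_ge_atTop 4] with T hT h4
  set N := T / 4 with hNdef
  have hN1 : 1 ≤ N := by omega
  have h4N : 4 * N ≤ T := by omega
  have hT3 : T ≤ 4 * N + 3 := by omega
  have hNr : (1 : ℝ) ≤ N := by exact_mod_cast hN1
  have hN0 : (0 : ℝ) < N := by linarith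
  have hsN0 : 0 < Real.sqrt N := Real.sqrt_pos.2 hN0
  have hTr : (4 : ℝ) ≤ T := by exact_mod_cast h4
  have hsT0 : 0 < Real.sqrt T := Real.sqrt_pos.2 (by linarith)
  have hmono : Real.log (stripConnectiveConstant (4 * N)) ≤ Real.log (stripConnectiveConstant T) :=
    Real.log_le_log (stripConnectiveConstant_pos _) (stripConnectiveConstant_mono h4N)
  have hrate := log_sub_log_stripConnectiveConstant_four_mul_le hN1
  have hlog2N : Real.log (2 * N + 1) ≤ Real.log 3 + Real.log N := by
    rw [← Real.log_mul (by norm_num) hN0.ne']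
    exact Real.log_le_log (by linarith) (by linarith)
  have hs43 : Real.sqrt (4 * N + 3) = Real.sqrt N * Real.sqrt (4 + 3 / (N : ℝ)) := by
    rw [← Real.sqrt_mul hN0.le]
    congr 1
    field_simp
  have hs43pos : 0 < Real.sqrt (4 * (N : ℝ) + 3) := Real.sqrt_pos.2 (by linarith)
  have hNsq : (N : ℝ) = Real.sqrt N * Real.sqrt N := (Real.mul_self_sqrt hN0.le).symm
  have hkey : (15 * Real.sqrt N + Real.log (2 * N + 1)) / N ≤
      ((Real.log 3 + Real.log N) / Real.sqrt N + 15) * Real.sqrt (4 + 3 / (N : ℝ)) / Real.sqrt (4 * N + 3) := by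
    rw [hs43, mul_div_mul_comm, div_self (ne_of_gt (Real.sqrt_pos.2 (by positivity))), mul_one,
      div_add' _ _ _ hsN0.ne', div_div, ← hNsq]
    exact div_le_div_of_nonneg_right (by linarith) hN0.le
  have hsT : Real.sqrt T ≤ Real.sqrt (4 * N + 3) := Real.sqrt_le_sqrt (by exact_mod_cast hT3)
  calc logMuTri - Real.log (stripConnectiveConstant T)
      ≤ logMuTri - Real.log (stripConnectiveConstant (4 * N)) := by linarith
    _ ≤ _ := hrate.trans hkey
    _ ≤ (30 + η) / Real.sqrt (4 * N + 3) := div_le_div_of_nonneg_right hT hs43pos.le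
    _ ≤ (30 + η) / Real.sqrt T := div_le_div_of_nonneg_left (by linarith) hsT0 hsT

end TriStrip

end Literature.Probability.RandomPlanarGeometry.SAW
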